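import Summits.Ventures.YMGap.RobustBall.BlockCLTCriterion
import Summits.Ventures.YMGap.RobustBall.BoxBlocks
import Summits.Ventures.YMGap.RobustBall.BoxSumCLTTools
import HarnessLib

/-!
# Venture YMGap, track ROBUST-BALL — THE BOX-SUM CENTRAL LIMIT THEOREM: Gaussian fluctuations of `Σ_{x∈B_n} f∘θ_x` at the
# `√volume` scale for a translation-invariant lattice state with Lipschitz pair clustering

HONEST FRAMING. WHAT THIS IS: a venture file (cell `pub-ymgap`, track Y2 ROBUST-BALL, seat ds-3, theorems only): the object «C-CLT»,
generic part. `μ` is a translation-invariant probability measure on the `ℤ^d` link configurations (`d ≥ 1`), `f` a bounded measurable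
observable with absolutely summable autocovariance `c(v) = cov_μ(f, f∘θ_v)` (the hypotheses of `ThermodynamicVariance.lean`) AND an
explicit PAIR CLUSTERING BOUND for bounded `1`-Lipschitz functions `φ, ψ` of scaled block sums:
`|cov_μ(φ(a Σ_{x∈P} f∘θ_x), ψ(a Σ_{y∈Q} f∘θ_y))| ≤ A (#P + #Q)² (1 + a² #P #Q) e^{−m D}` whenever `P, Q` are `D`-separated in the sup
norm and `D ≥ R₀`. THEN (★★★ `tendstoInDistribution_boxSum`)
`(Σ_{x∈B_n} f∘θ_x − #B_n · μ(f)) / √#B_n ⟶ N(0, χ(f))` in distribution, `χ(f) = Σ_{v∈ℤ^d} cov_μ(f, f∘θ_v)` (the susceptibility of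
`ThermodynamicVariance.tendsto_variance_boxSum_div`; `χ(f) ≥ 0`, the degenerate case included), `B_n = siteBox d n` the centred box of
side `2n+1`. Proof = Bernstein blocks (`BoxBlocks.exists_blockParams`: polylogarithmic blocks and corridors) fed into the criterion
`BlockCLT.tendsto_integral_cexp_of_blocks` + Lévy (`BlockCLT.tendstoInDistribution_of_tendsto_integral_cexp`): the corridor/boundary
remainder is `o(1)` in `L²` by `ErgodicAverages.variance_boxSum_le`; the blocks are identically distributed by translation invariance; the
block variance is `ThermodynamicVariance.tendsto_variance_boxSum_div` along the block radii; the dependence defect is killed by the pair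
clustering bound applied to `cos/sin` of block sums (`BoxSumCLTTools.norm_integral_cexp_add_sub_le`).
WHAT THIS IS NOT: no rate of convergence; `χ(f) > 0` is NOT asserted; lattice statement only — nothing about the continuum or Clay.
The `SU(2)` Yang–Mills cell is `BoxSumCLTSU2.lean`. References: E. Bolthausen, Ann. Probab. 10 (1982) 1047–1050; C. M. Newman, CMP 74
(1980) 119–128; H. Künsch, CMP 84 (1982) 207–222 (CLT under Dobrushin uniqueness); I. A. Ibragimov, Yu. V. Linnik (1971), Ch. 18.
-/

noncomputable section

open MeasureTheory ProbabilityTheory Filter Topology Complex Finset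
open Literature.Probability.LatticeModels hiding configShift configShift_apply
open Literature.MathematicalPhysics.QuantumLattice

namespace Summit.Ventures.YMGap.RobustBall

namespace BoxSumCLT

variable {d : ℕ} {G : Type*} [MeasurableSpace G]

/-- ★★★ **THE BOX-SUM CENTRAL LIMIT THEOREM.** Let `d ≥ 1`, `μ` a translation-invariant probability measure on the `ℤ^d` link
configurations, `f` measurable with `|f| ≤ M`, and suppose the PAIR CLUSTERING BOUND: for all
finite `P, Q ⊆ ℤ^d`, reals `D ≥ R₀` and `a`, and `1`-Lipschitz `φ, ψ : ℝ → ℝ` bounded by `1`, if `‖x − y‖_∞ ≥ D` for all `x ∈ P`, `y ∈ Q`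
then `|cov_μ(φ(a Σ_{x∈P} f∘θ_x), ψ(a Σ_{y∈Q} f∘θ_y))| ≤ A (#P + #Q)² (1 + a² #P #Q) e^{−m D}` (`m > 0`, `A ≥ 0`). Then for every random
variable `Z` with law `N(0, χ(f))`, `χ(f) = Σ_v cov_μ(f, f∘θ_v)` (absolutely summable by `summable_abs_cov_of_pairClustering`):
`(Σ_{x∈B_n} f∘θ_x − #B_n μ(f)) / √#B_n → Z` in distribution. [folklore] -/
theorem tendstoInDistribution_boxSum (hd : 1 ≤ d) {μ : Measure (LGConfig d G)} [IsProbabilityMeasure μ]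
    (hμ : IsZdTranslationInvariant μ) {f : LGConfig d G → ℝ} (hfm : Measurable f) {M : ℝ} (hfb : ∀ U, |f U| ≤ M)
    {R₀ mr A : ℝ} (hmr : 0 < mr) (hA : 0 ≤ A)
    (hcl : ∀ (P Q : Finset (Site d)) (D a : ℝ) (φ ψ : ℝ → ℝ), R₀ ≤ D → (∀ x ∈ P, ∀ y ∈ Q, D ≤ ‖x - y‖) →
      LipschitzWith 1 φ → LipschitzWith 1 ψ → (∀ z, |φ z| ≤ 1) → (∀ z, |ψ z| ≤ 1) →
      |cov[fun U => φ (a * ∑ x ∈ P, f (configShift x U)), fun U => ψ (a * ∑ y ∈ Q, f (configShift y U)); μ]| ≤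
        A * ((P.card : ℝ) + Q.card) ^ 2 * (1 + a ^ 2 * P.card * Q.card) * Real.exp (-mr * D))
    {Ω' : Type*} [MeasurableSpace Ω'] {P' : Measure Ω'} [IsProbabilityMeasure P'] {Z : Ω' → ℝ}
    (hZ : HasLaw Z (gaussianReal 0 (∑' v, cov[f, fun U => f (configShift v U); μ]).toNNReal) P') :
    TendstoInDistribution
      (fun n U => (∑ x ∈ siteBox d n, f (configShift x U) - (siteBox d n).card * ∫ V, f V ∂μ) / Real.sqrt ((siteBox d n).card))
      atTop Z (fun _ => μ) P' := by
  classical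
  have hsum : Summable fun v : Site d => |cov[f, fun U => f (configShift v U); μ]| :=
    summable_abs_cov_of_pairClustering hd hfm hfb hmr hA hcl
  obtain ⟨m, q, K, hKL, hm, hq, hsmall, hcover, hdecay⟩ := BoxBlocks.exists_blockParams d hd
  set a₀ : ℝ := ∫ V, f V ∂μ with ha₀
  set fb : LGConfig d G → ℝ := fun U => f U - a₀ with hfbdef
  have hfbm : Measurable fb := hfm.sub_const _
  have hfbb : ∀ U, |fb U| ≤ 2 * |M| := fun U =>
    (abs_sub_integral_le hfb U).trans (by linarith [le_abs_self M])
  have hfb0 : ∫ U, fb U ∂μ = 0 := by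
    have hfi : Integrable f μ := (integrable_const M).mono' hfm.aestronglyMeasurable
      (Eventually.of_forall fun U => by simpa [Real.norm_eq_abs] using hfb U)
    simp only [hfbdef]
    rw [integral_sub hfi (integrable_const _), integral_const]
    simp [ha₀]
  have hcovfb : ∀ v, cov[fb, fun U => fb (configShift v U); μ] = cov[f, fun U => f (configShift v U); μ] := fun v =>
    covariance_centred hfm hfb a₀ v
  have hsum' : Summable fun v : Site d => |cov[fb, fun U => fb (configShift v U); μ]| := by
    simp_rw [hcovfb]; exact hsum
  set χ : ℝ := ∑' v, cov[f, fun U => f (configShift v U); μ] with hχ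
  have hχ' : ∑' v, cov[fb, fun U => fb (configShift v U); μ] = χ := by simp_rw [hcovfb]; rfl
  have hχ0 : 0 ≤ χ := by
    rw [← hχ']; exact ThermodynamicVariance.tsum_covariance_shift_nonneg hμ hfbm hfbb hsum'
  set Acov : ℝ := ∑' v, |cov[fb, fun U => fb (configShift v U); μ]| with hAcov
  have hAcov0 : 0 ≤ Acov := tsum_nonneg fun _ => abs_nonneg _
  set s : ℕ → ℝ := fun n => Real.sqrt ((siteBox d n).card) with hs
  have hcardR : ∀ n, ((siteBox d n).card : ℝ) = (2 * (n : ℝ) + 1) ^ d := ErgodicAverages.card_siteBox_cast d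
  have hs_pos : ∀ n, 0 < s n := fun n => Real.sqrt_pos.2 (by rw [hcardR]; positivity)
  have hs_sq : ∀ n, s n ^ 2 = (siteBox d n).card := fun n => Real.sq_sqrt (Nat.cast_nonneg _)
  set L : ℕ → ℕ := fun n => 2 * m n + 1 + q n with hL
  set z : (n : ℕ) → (Fin d → Fin (K n)) → Site d := fun n c i => -(n : ℤ) + m n + (c i : ℕ) * (L n : ℕ) with hz
  set blk : (n : ℕ) → (Fin d → Fin (K n)) → Finset (Site d) := fun n c => (siteBox d (m n)).image (fun y => y + z n c)
    with hblk
  set g : ℕ → LGConfig d G → ℝ := fun n U => (∑ y ∈ siteBox d (m n), fb (configShift y U)) / s n with hg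
  have hgm : ∀ n, Measurable (g n) := fun n =>
    (Finset.measurable_sum _ fun y _ => hfbm.comp (configShift y).measurable).div_const _
  have hg_shift : ∀ n c U, g n (configShift (z n c) U) = (∑ x ∈ blk n c, fb (configShift x U)) / s n := by
    intro n c U
    simp only [hg, hblk]
    rw [BoxBlocks.sum_image_add]
    congr 1
    refine Finset.sum_congr rfl fun y _ => ?_
    rw [configShift_add]
  set e : (n : ℕ) → (Fin d → Fin (K n)) ≃ Fin (K n ^ d) := fun n => finFunctionFinEquiv with he
  obtain ⟨Y, hY⟩ : ∃ Y : ℕ → ℕ → LGConfig d G → ℝ,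
      Y = fun n j U => if h : j < K n ^ d then g n (configShift (z n ((e n).symm ⟨j, h⟩)) U) else 0 := ⟨_, rfl⟩
  set Rem : ℕ → Finset (Site d) := fun n => siteBox d n \ Finset.univ.biUnion (blk n) with hRem
  set R : ℕ → LGConfig d G → ℝ := fun n U => (∑ x ∈ Rem n, fb (configShift x U)) / s n with hR
  set T : ℕ → LGConfig d G → ℝ := fun n U =>
    (∑ x ∈ siteBox d n, f (configShift x U) - (siteBox d n).card * ∫ V, f V ∂μ) / Real.sqrt ((siteBox d n).card) with hT
  set b : ℕ → ℝ := fun n => 2 * |M| * ((2 * m n + 1 : ℕ) : ℝ) ^ d / s n with hb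
  have hKL' : ∀ n, K n * (2 * m n + 1 + q n) ≤ 2 * n + 1 := hKL
  have hblk_sub : ∀ n c, blk n c ⊆ siteBox d n := fun n c => BoxBlocks.block_subset (hKL' n) c
  have hblk_card : ∀ n c, (blk n c).card = (2 * m n + 1) ^ d := fun n c => BoxBlocks.card_image_add _ _
  have hblk_disj : ∀ n c c', c ≠ c' → Disjoint (blk n c) (blk n c') := fun n c c' h => BoxBlocks.blocks_disjoint (hKL' n) h
  have hblk_apart : ∀ n c c', c ≠ c' → ∀ x ∈ blk n c, ∀ y ∈ blk n c', (q n : ℝ) + 1 ≤ ‖x - y‖ :=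
    fun n c c' h x hx y hy => BoxBlocks.blocks_apart (hKL' n) h hx hy
  have hsplit : ∀ n (w : Site d → ℝ), ∑ x ∈ siteBox d n, w x = (∑ c, ∑ x ∈ blk n c, w x) + ∑ x ∈ Rem n, w x :=
    fun n w => BoxBlocks.sum_siteBox_eq_blocks_add_remainder (hKL' n) w
  have hRem_card : ∀ n, ((Rem n).card : ℝ) = (siteBox d n).card - ((K n * (2 * m n + 1) : ℕ) : ℝ) ^ d := by
    intro n
    have h := BoxBlocks.card_remainder (d := d) (hKL' n)
    have hle := BoxBlocks.blocks_card_le (d := d) (hKL' n)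
    simp only [hRem, hblk, hz, hL] at h ⊢
    rw [h, Nat.cast_sub hle, ThermodynamicVariance.card_siteBox]
    push_cast
    simp only [mul_pow]
  have hY_of_lt : ∀ n j (h : j < K n ^ d), Y n j = fun U => g n (configShift (z n ((e n).symm ⟨j, h⟩)) U) := by
    intro n j h; rw [hY]; funext U; simp only [dif_pos h]
  have hY_of_not : ∀ n j, ¬ j < K n ^ d → Y n j = fun _ => 0 := by
    intro n j h; rw [hY]; funext U; simp only [dif_neg h]
  have hYm : ∀ n j, Measurable (Y n j) := by
    intro n j
    by_cases h : j < K n ^ d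
    · rw [hY_of_lt n j h]; exact (hgm n).comp (configShift _).measurable
    · rw [hY_of_not n j h]; exact measurable_const
  have hsum_abs_le : ∀ (S : Finset (Site d)) (U : LGConfig d G), |∑ x ∈ S, fb (configShift x U)| ≤ S.card * (2 * |M|) :=
    fun S U => (Finset.abs_sum_le_sum_abs _ _).trans (by
      rw [← nsmul_eq_mul, ← Finset.sum_const]; exact Finset.sum_le_sum fun x _ => hfbb _)
  have hg_bound : ∀ n U, |g n U| ≤ b n := by
    intro n U
    simp only [hg, hb]
    rw [abs_div, abs_of_pos (hs_pos n), div_le_div_iff_of_pos_right (hs_pos n)]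
    refine (hsum_abs_le _ _).trans ?_
    rw [ThermodynamicVariance.card_siteBox]; push_cast; ring_nf; rfl
  have hb_nonneg : ∀ n, 0 ≤ b n := fun n => by simp only [hb]; positivity
  have hb' : ∀ n j U, |Y n j U| ≤ b n := by
    intro n j U
    by_cases h : j < K n ^ d
    · rw [hY_of_lt n j h]; exact hg_bound n _
    · rw [hY_of_not n j h]; simpa using hb_nonneg n
  have hg_int0 : ∀ n, ∫ U, g n U ∂μ = 0 := by
    intro n
    simp only [hg]
    rw [integral_div, integral_finsetSum _ (fun y _ => ?_)]
    · simp [ErgodicAverages.integral_comp_shift hμ fb, hfb0]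
    · exact ((integrable_const (2 * |M|)).mono' (hfbm.comp (configShift y).measurable).aestronglyMeasurable
        (Eventually.of_forall fun U => by simpa [Real.norm_eq_abs] using hfbb _))
  have h0 : ∀ n, ∫ U, Y n 0 U ∂μ = 0 := by
    intro n
    by_cases h : 0 < K n ^ d
    · rw [hY_of_lt n 0 h, ErgodicAverages.integral_comp_shift hμ (g n)]; exact hg_int0 n
    · rw [hY_of_not n 0 h]; simp
  have hid : ∀ n, ∀ j < K n ^ d, IdentDistrib (Y n j) (Y n 0) μ μ := by
    intro n j hj
    have h0' : 0 < K n ^ d := lt_of_le_of_lt (Nat.zero_le j) hj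
    rw [hY_of_lt n j hj, hY_of_lt n 0 h0']
    exact identDistrib_comp_configShift hμ (hgm n) _ _
  have hS_int : ∀ (S : Finset (Site d)), Integrable (fun U => ∑ x ∈ S, fb (configShift x U)) μ := fun S =>
    integrable_finsetSum _ fun x _ => (integrable_const (2 * |M|)).mono' (hfbm.comp (configShift x).measurable).aestronglyMeasurable
      (Eventually.of_forall fun U => by simpa [Real.norm_eq_abs] using hfbb _)
  have hS_meas : ∀ (S : Finset (Site d)), Measurable (fun U => ∑ x ∈ S, fb (configShift x U)) := fun S =>
    Finset.measurable_sum _ fun x _ => hfbm.comp (configShift x).measurable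
  have hS_int0 : ∀ (S : Finset (Site d)), ∫ U, ∑ x ∈ S, fb (configShift x U) ∂μ = 0 := fun S => by
    rw [integral_finsetSum _ (fun x _ => (hS_int {x}).congr (Eventually.of_forall fun U => by simp))]
    simp [ErgodicAverages.integral_comp_shift hμ fb, hfb0]
  -- `∫ (Σ_S fb∘θ / s n)² = Var(Σ_S fb∘θ)/#B_n ≤ #S · Acov / #B_n`
  have hsq_int : ∀ n (S : Finset (Site d)), ∫ U, ((∑ x ∈ S, fb (configShift x U)) / s n) ^ 2 ∂μ =
      Var[fun U => ∑ x ∈ S, fb (configShift x U); μ] / (siteBox d n).card := by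
    intro n S
    simp_rw [div_pow]
    rw [integral_div, hs_sq, variance_of_integral_eq_zero (hS_meas S).aemeasurable (hS_int0 S)]
  -- (hR): the remainder is small in `L¹`
  have hRi : ∀ n, Integrable (R n) μ := fun n => (hS_int (Rem n)).div_const _
  have hR : Tendsto (fun n => ∫ U, |R n U| ∂μ) atTop (𝓝 0) := by
    have hfrac : Tendsto (fun n => ((Rem n).card : ℝ) / (siteBox d n).card) atTop (𝓝 0) := by
      have h1 : Tendsto (fun n => (1 : ℝ) - ((K n * (2 * m n + 1) : ℕ) : ℝ) ^ d / ((2 * n + 1 : ℕ) : ℝ) ^ d) atTop (𝓝 0) := by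
        simpa using (tendsto_const_nhds (x := (1 : ℝ))).sub hcover
      refine h1.congr fun n => ?_
      rw [hRem_card n, sub_div, hcardR, div_self (by positivity)]
      push_cast; ring
    have hup : Tendsto (fun n => Real.sqrt (((Rem n).card : ℝ) / (siteBox d n).card * Acov)) atTop (𝓝 0) := by
      simpa using (hfrac.mul_const Acov).sqrt
    refine squeeze_zero (fun n => integral_nonneg fun U => abs_nonneg _) (fun n => ?_) hup
    have hRb : ∀ U, |R n U| ≤ (Rem n).card * (2 * |M|) / s n := fun U => by
      simp only [hR]; rw [abs_div, abs_of_pos (hs_pos n)]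
      exact div_le_div_of_nonneg_right (hsum_abs_le _ _) (hs_pos n).le
    refine (integral_abs_le_sqrt_integral_sq (hRi n).aestronglyMeasurable hRb).trans (Real.sqrt_le_sqrt ?_)
    have h := hsq_int n (Rem n)
    simp only [hR] at h ⊢
    rw [h, div_mul_eq_mul_div]
    exact div_le_div_of_nonneg_right (ErgodicAverages.variance_boxSum_le hμ hfbm hfbb hsum' (Rem n)) (Nat.cast_nonneg _)
  -- (hv): `K^d · E[(Y n 0)²] → χ`
  have hb0 : Tendsto b atTop (𝓝 0) := by
    have h := hsmall.const_mul (2 * |M|)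
    rw [mul_zero] at h
    refine h.congr fun n => ?_
    simp only [hb, hs]
    rw [hcardR]; push_cast; ring
  have hvar_lim : Tendsto (fun n => Var[fun U => ∑ y ∈ siteBox d (m n), fb (configShift y U); μ] / (siteBox d (m n)).card)
      atTop (𝓝 χ) := by
    rw [← hχ']
    exact (ThermodynamicVariance.tendsto_variance_boxSum_div hμ hfbm hfbb hsum').comp hm
  have hY0sq : ∀ n, ((K n ^ d : ℕ) : ℝ) * ∫ U, Y n 0 U ^ 2 ∂μ =
      (((K n * (2 * m n + 1) : ℕ) : ℝ) ^ d / ((2 * n + 1 : ℕ) : ℝ) ^ d) *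
        (Var[fun U => ∑ y ∈ siteBox d (m n), fb (configShift y U); μ] / (siteBox d (m n)).card) := by
    intro n
    by_cases h : 0 < K n ^ d
    · rw [hY_of_lt n 0 h]
      simp only
      rw [integral_sq_comp_configShift hμ (g n)]
      simp only [hg]
      rw [hsq_int n (siteBox d (m n)), hcardR, hcardR]
      have hpos : (0 : ℝ) < (2 * (m n : ℝ) + 1) ^ d := by positivity
      push_cast
      rw [mul_pow]
      field_simp
    · have hK0 : K n ^ d = 0 := by omega
      rw [hK0]
      push_cast
      rw [mul_pow, ← Nat.cast_pow, hK0]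
      simp
  have hv : Tendsto (fun n => ((K n ^ d : ℕ) : ℝ) * ∫ U, Y n 0 U ^ 2 ∂μ) atTop (𝓝 χ) := by
    have h := hcover.mul hvar_lim
    rw [one_mul] at h
    exact h.congr fun n => (hY0sq n).symm
  -- (hT): the decomposition
  have hTdec : ∀ n U, T n U = (∑ j ∈ range (K n ^ d), Y n j U) + R n U := by
    intro n U
    have h1 : ∑ j ∈ range (K n ^ d), Y n j U = ∑ c : Fin d → Fin (K n), (∑ x ∈ blk n c, fb (configShift x U)) / s n := by
      rw [← Fin.sum_univ_eq_sum_range (fun j => Y n j U), ← (e n).sum_comp]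
      refine Finset.sum_congr rfl fun c _ => ?_
      rw [hY_of_lt n _ (e n c).2]
      simp only [Fin.eta, Equiv.symm_apply_apply]
      exact hg_shift n c U
    have h2 : ∑ x ∈ siteBox d n, f (configShift x U) - (siteBox d n).card * ∫ V, f V ∂μ =
        ∑ x ∈ siteBox d n, fb (configShift x U) := by
      simp only [hfbdef, Finset.sum_sub_distrib, Finset.sum_const, nsmul_eq_mul, ha₀]
    simp only [hT]
    rw [h1, h2, hsplit n (fun x => fb (configShift x U)), add_div, Finset.sum_div]
  have hTm : ∀ n, AEMeasurable (T n) μ := fun n => by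
    have : T n = fun U => (∑ j ∈ range (K n ^ d), Y n j U) + R n U := funext (hTdec n)
    rw [this]
    exact ((Finset.measurable_sum _ fun j _ => hYm n j).add ((hS_meas (Rem n)).div_const _)).aemeasurable
  -- (hdep): the dependence defect, through the pair clustering bound on `cos/sin` of block sums
  have hdep : ∀ t : ℝ, Tendsto (fun n => ∑ j ∈ range (K n ^ d),
      ‖(∫ U, cexp (((t * ∑ i ∈ Ico j (K n ^ d), Y n i U : ℝ) : ℂ) * I) ∂μ) -
        (∫ U, cexp (((t * Y n j U : ℝ) : ℂ) * I) ∂μ) *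
          ∫ U, cexp (((t * ∑ i ∈ Ico (j + 1) (K n ^ d), Y n i U : ℝ) : ℂ) * I) ∂μ‖) atTop (𝓝 0) := by
    intro t
    -- the uniform bound on one term, valid once `q n + 1 ≥ R₀`
    set Bn : ℕ → ℝ := fun n => A * (2 * ((siteBox d n).card : ℝ)) ^ 2 * (1 + t ^ 2 * (siteBox d n).card) *
      Real.exp (-mr * ((q n : ℝ) + 1)) with hBn
    have hBn0 : ∀ n, 0 ≤ Bn n := fun n => by
      simp only [hBn]
      exact mul_nonneg (mul_nonneg (mul_nonneg hA (sq_nonneg _))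
        (add_nonneg zero_le_one (mul_nonneg (sq_nonneg t) (Nat.cast_nonneg _)))) (Real.exp_pos _).le
    have hterm : ∀ n, R₀ ≤ (q n : ℝ) + 1 → ∀ j < K n ^ d,
        ‖(∫ U, cexp (((t * ∑ i ∈ Ico j (K n ^ d), Y n i U : ℝ) : ℂ) * I) ∂μ) -
          (∫ U, cexp (((t * Y n j U : ℝ) : ℂ) * I) ∂μ) *
            ∫ U, cexp (((t * ∑ i ∈ Ico (j + 1) (K n ^ d), Y n i U : ℝ) : ℂ) * I) ∂μ‖ ≤ 4 * Bn n := by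
      intro n hR₀ j hj
      have hk0 : 0 < K n ^ d := lt_of_le_of_lt (Nat.zero_le j) hj
      -- block indices along `Ico (j+1) k`, their union `Q`, the block `P`
      obtain ⟨cidx, hcidx⟩ : ∃ cidx : ℕ → (Fin d → Fin (K n)),
          cidx = fun i => if h : i < K n ^ d then (e n).symm ⟨i, h⟩ else (e n).symm ⟨0, hk0⟩ := ⟨_, rfl⟩
      have hcidx_of_lt : ∀ i (h : i < K n ^ d), cidx i = (e n).symm ⟨i, h⟩ := fun i h => by rw [hcidx]; simp only [dif_pos h]
      have hcidx_inj : ∀ i i', i < K n ^ d → i' < K n ^ d → cidx i = cidx i' → i = i' := by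
        intro i i' hi hi' h
        rw [hcidx_of_lt i hi, hcidx_of_lt i' hi'] at h
        have := (e n).symm.injective h
        simpa using this
      have hYc : ∀ i (h : i < K n ^ d) U, Y n i U = (∑ x ∈ blk n (cidx i), fb (configShift x U)) / s n := by
        intro i h U; rw [hY_of_lt n i h, hcidx_of_lt i h]; exact hg_shift n _ U
      set P : Finset (Site d) := blk n (cidx j) with hP
      obtain ⟨Q, hQdef⟩ : ∃ Q : Finset (Site d), Q = (Ico (j + 1) (K n ^ d)).biUnion (fun i => blk n (cidx i)) := ⟨_, rfl⟩
      have hPsub : P ⊆ siteBox d n := hblk_sub n _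
      have hQsub : Q ⊆ siteBox d n := by rw [hQdef]; exact Finset.biUnion_subset.2 fun i _ => hblk_sub n _
      have hapartPQ : ∀ x ∈ P, ∀ y ∈ Q, (q n : ℝ) + 1 ≤ ‖x - y‖ := by
        intro x hx y hy
        rw [hQdef] at hy
        obtain ⟨i, hi, hyi⟩ := Finset.mem_biUnion.1 hy
        have hi' := Finset.mem_Ico.1 hi
        refine hblk_apart n (cidx j) (cidx i) (fun hci => ?_) x hx y hyi
        have := hcidx_inj j i hj hi'.2 hci
        omega
      -- the two phases as functions of the block sums
      set a : ℝ := t / s n with ha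
      obtain ⟨X, hXdef⟩ : ∃ X : LGConfig d G → ℝ, X = fun U => t * Y n j U := ⟨_, rfl⟩
      obtain ⟨X', hX'def⟩ : ∃ X' : LGConfig d G → ℝ, X' = fun U => t * ∑ i ∈ Ico (j + 1) (K n ^ d), Y n i U := ⟨_, rfl⟩
      have hXm : Measurable X := by rw [hXdef]; exact (hYm n j).const_mul t
      have hX'm : Measurable X' := by rw [hX'def]; exact (Finset.measurable_sum _ fun i _ => hYm n i).const_mul t
      have hsumfb : ∀ (S : Finset (Site d)) U, ∑ x ∈ S, fb (configShift x U) = (∑ x ∈ S, f (configShift x U)) - S.card * a₀ := by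
        intro S U; simp only [hfbdef, Finset.sum_sub_distrib, Finset.sum_const, nsmul_eq_mul]
      have hXeq : ∀ U, X U = a * ∑ x ∈ P, f (configShift x U) - a * (P.card * a₀) := by
        intro U; rw [hXdef]; simp only [ha]; rw [hYc j hj U, hsumfb]; ring
      have hX'eq : ∀ U, X' U = a * ∑ x ∈ Q, f (configShift x U) - a * (Q.card * a₀) := by
        intro U
        rw [hX'def]; simp only [ha]
        have hsumY : ∑ i ∈ Ico (j + 1) (K n ^ d), Y n i U = (∑ x ∈ Q, fb (configShift x U)) / s n := by
          rw [hQdef, Finset.sum_biUnion (fun i hi i' hi' hne => hblk_disj n _ _ fun hc =>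
            hne (hcidx_inj i i' (Finset.mem_Ico.1 hi).2 (Finset.mem_Ico.1 hi').2 hc)), Finset.sum_div]
          exact Finset.sum_congr rfl fun i hi => hYc i (Finset.mem_Ico.1 hi).2 U
        rw [hsumY, hsumfb]; ring
      -- the defect in terms of `X, X'`
      have hdefect : ‖(∫ U, cexp (((t * ∑ i ∈ Ico j (K n ^ d), Y n i U : ℝ) : ℂ) * I) ∂μ) -
          (∫ U, cexp (((t * Y n j U : ℝ) : ℂ) * I) ∂μ) *
            ∫ U, cexp (((t * ∑ i ∈ Ico (j + 1) (K n ^ d), Y n i U : ℝ) : ℂ) * I) ∂μ‖ =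
          ‖(∫ U, cexp (((X U + X' U : ℝ) : ℂ) * I) ∂μ) -
            (∫ U, cexp (((X U : ℝ) : ℂ) * I) ∂μ) * ∫ U, cexp (((X' U : ℝ) : ℂ) * I) ∂μ‖ := by
        have hsplitIco : ∀ U, t * ∑ i ∈ Ico j (K n ^ d), Y n i U = X U + X' U := fun U => by
          rw [hXdef, hX'def]; simp only; rw [Finset.sum_eq_sum_Ico_succ_bot hj]; ring
        simp_rw [hsplitIco, hXdef, hX'def]
      rw [hdefect]
      refine (norm_defect_le_of_pairClustering hcl hR₀ hapartPQ a a₀ hXm hX'm hXeq hX'eq).trans ?_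
      -- `(#P + #Q)² ≤ (2#B)²`, `a² #P #Q ≤ t² #B`
      have hPc : (P.card : ℝ) ≤ (siteBox d n).card := by exact_mod_cast Finset.card_le_card hPsub
      have hQc : (Q.card : ℝ) ≤ (siteBox d n).card := by exact_mod_cast Finset.card_le_card hQsub
      have hBpos : (0 : ℝ) < (siteBox d n).card := by rw [hcardR]; positivity
      have ha2 : a ^ 2 * P.card * Q.card ≤ t ^ 2 * (siteBox d n).card := by
        rw [ha, div_pow, hs_sq,
          show t ^ 2 / ((siteBox d n).card : ℝ) * P.card * Q.card = t ^ 2 * (P.card * Q.card / (siteBox d n).card) by ring]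
        refine mul_le_mul_of_nonneg_left ?_ (sq_nonneg t)
        rw [div_le_iff₀ hBpos]
        exact mul_le_mul hPc hQc (Nat.cast_nonneg _) (Nat.cast_nonneg _)
      have hPQ0 : (0 : ℝ) ≤ (P.card : ℝ) + Q.card := add_nonneg (Nat.cast_nonneg _) (Nat.cast_nonneg _)
      have hsum2 : ((P.card : ℝ) + Q.card) ^ 2 ≤ (2 * ((siteBox d n).card : ℝ)) ^ 2 :=
        pow_le_pow_left₀ hPQ0 (by linarith) 2
      have hexp0 : 0 ≤ Real.exp (-mr * ((q n : ℝ) + 1)) := (Real.exp_pos _).le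
      simp only [hBn]
      have h1 : A * ((P.card : ℝ) + Q.card) ^ 2 ≤ A * (2 * ((siteBox d n).card : ℝ)) ^ 2 := mul_le_mul_of_nonneg_left hsum2 hA
      have h2 : (1 : ℝ) + a ^ 2 * P.card * Q.card ≤ 1 + t ^ 2 * (siteBox d n).card := by linarith
      have h4 : (0 : ℝ) ≤ 1 + a ^ 2 * P.card * Q.card :=
        add_nonneg zero_le_one (mul_nonneg (mul_nonneg (sq_nonneg a) (Nat.cast_nonneg _)) (Nat.cast_nonneg _))
      have h5 : (0 : ℝ) ≤ A * (2 * ((siteBox d n).card : ℝ)) ^ 2 := mul_nonneg hA (sq_nonneg _)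
      exact mul_le_mul_of_nonneg_left (mul_le_mul_of_nonneg_right (mul_le_mul h1 h2 h4 h5) hexp0) (by norm_num)
    -- summing `K^d ≤ #B_n` terms and letting `n → ∞`
    have hev : ∀ᶠ n in atTop, R₀ ≤ (q n : ℝ) + 1 := by
      have h := (tendsto_natCast_atTop_atTop (R := ℝ)).comp hq
      filter_upwards [h.eventually_ge_atTop (R₀ - 1)] with n hn
      simp only [Function.comp] at hn
      linarith
    have hKd_le : ∀ n, ((K n ^ d : ℕ) : ℝ) ≤ (siteBox d n).card := fun n => by
      have h1 := BoxBlocks.blocks_card_le (d := d) (hKL' n)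
      have h2 : K n ^ d ≤ K n ^ d * (2 * m n + 1) ^ d := Nat.le_mul_of_pos_right _ (pow_pos (by omega) _)
      rw [ThermodynamicVariance.card_siteBox]
      exact_mod_cast h2.trans h1
    have hlim : Tendsto (fun n => ((siteBox d n).card : ℝ) * (4 * Bn n)) atTop (𝓝 0) := by
      -- `#B · 4 · Bn ≤ 16 A (1 + t²) N^{4d} e^{−mr q}` and `hdecay`
      have hdec := (hdecay mr hmr).const_mul (16 * A * (1 + t ^ 2))
      rw [mul_zero] at hdec
      refine squeeze_zero (fun n => mul_nonneg (Nat.cast_nonneg _) (mul_nonneg (by norm_num) (hBn0 n))) (fun n => ?_) hdec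
      -- write everything through `N = #B_n = (2n+1)^d`
      set N : ℝ := ((siteBox d n).card : ℝ) with hNdef
      have hN1 : (1 : ℝ) ≤ N := by
        rw [hNdef, hcardR]; exact one_le_pow₀ (by have := (Nat.cast_nonneg n : (0:ℝ) ≤ n); linarith)
      have hN0 : (0 : ℝ) ≤ N := zero_le_one.trans hN1
      have hN4 : N ^ 4 = ((2 * n + 1 : ℕ) : ℝ) ^ (4 * d) := by
        rw [hNdef, hcardR, ← pow_mul, mul_comm]; push_cast; ring
      have hexp : Real.exp (-mr * ((q n : ℝ) + 1)) ≤ Real.exp (-mr * (q n : ℝ)) :=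
        Real.exp_le_exp.2 (by nlinarith)
      have h1t : 1 + t ^ 2 * N ≤ (1 + t ^ 2) * N := by nlinarith [sq_nonneg t]
      have hstep : A * (2 * N) ^ 2 * (1 + t ^ 2 * N) * Real.exp (-mr * ((q n : ℝ) + 1)) ≤
          A * (2 * N) ^ 2 * ((1 + t ^ 2) * N) * Real.exp (-mr * (q n : ℝ)) :=
        mul_le_mul (mul_le_mul_of_nonneg_left h1t (mul_nonneg hA (sq_nonneg _))) hexp (Real.exp_pos _).le
          (mul_nonneg (mul_nonneg hA (sq_nonneg _)) (mul_nonneg (by nlinarith [sq_nonneg t]) hN0))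
      simp only [hBn]
      rw [← hNdef]
      calc N * (4 * (A * (2 * N) ^ 2 * (1 + t ^ 2 * N) * Real.exp (-mr * ((q n : ℝ) + 1))))
          ≤ N * (4 * (A * (2 * N) ^ 2 * ((1 + t ^ 2) * N) * Real.exp (-mr * (q n : ℝ)))) :=
            mul_le_mul_of_nonneg_left (mul_le_mul_of_nonneg_left hstep (by norm_num)) hN0
        _ = 16 * A * (1 + t ^ 2) * (N ^ 4 * Real.exp (-mr * (q n : ℝ))) := by ring
        _ = 16 * A * (1 + t ^ 2) * (((2 * n + 1 : ℕ) : ℝ) ^ (4 * d) * Real.exp (-mr * (q n : ℝ))) := by rw [hN4]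
    refine squeeze_zero' (Eventually.of_forall fun n => Finset.sum_nonneg fun j _ => norm_nonneg _) ?_ hlim
    filter_upwards [hev] with n hn
    calc ∑ j ∈ range (K n ^ d), ‖(∫ U, cexp (((t * ∑ i ∈ Ico j (K n ^ d), Y n i U : ℝ) : ℂ) * I) ∂μ) -
          (∫ U, cexp (((t * Y n j U : ℝ) : ℂ) * I) ∂μ) *
            ∫ U, cexp (((t * ∑ i ∈ Ico (j + 1) (K n ^ d), Y n i U : ℝ) : ℂ) * I) ∂μ‖
        ≤ ∑ j ∈ range (K n ^ d), 4 * Bn n := Finset.sum_le_sum fun j hj => hterm n hn j (Finset.mem_range.1 hj)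
      _ = ((K n ^ d : ℕ) : ℝ) * (4 * Bn n) := by rw [Finset.sum_const, Finset.card_range, nsmul_eq_mul]
      _ ≤ ((siteBox d n).card : ℝ) * (4 * Bn n) :=
          mul_le_mul_of_nonneg_right (hKd_le n) (mul_nonneg (by norm_num) (hBn0 n))
  -- assemble: the criterion and Lévy
  have hlimT := BlockCLT.tendsto_integral_cexp_of_blocks (μ := μ) (T := T) (R := R) (Y := Y) (k := fun n => K n ^ d) (b := b)
    (σ2 := χ) hTdec hYm hRi hR hid h0 hb' hb0 (by exact_mod_cast hv) hdep
  exact BlockCLT.tendstoInDistribution_of_tendsto_integral_cexp hχ0 hTm hlimT hZ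

end BoxSumCLT

end Summit.Ventures.YMGap.RobustBall

end
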